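import Summits.CriticalPhenomena.PercolationContinuityZ3.Theorems.PercNearOneGluingNoHeavyLowerTailFrontierDecRowsUnmarkedEdgeKey
import Summits.CriticalPhenomena.PercolationContinuityZ3.Theorems.PercNearOneGluingNoHeavyLowerTailPatternCells
import HarnessLib

/-!
# Five-point pattern events in the 52-cell basis: the bridge from the KEY / polarised edge forms to `PatternCells`

Support file (prover seat `prim-bnk-1`, gen 9; `--supports stmt-CriticalPhenomena-4575`).  Bookkeeping definitions (`pairNo`, `mrel`, `liftPat`, `andPat`,
`ext4`), no named facts, no sorries, no `native_decide`.

PURPOSE.  The KEY form of a (terminal, unmarked) edge step of a four-terminal pattern row (`TerminalEdgeInduction.key_zero_one_connEvent`,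
`KeyHypAt`; likewise `polar₁_zero_one_connEvent` for `B₁, B₂`) is a cubic in `μ⁰`-probabilities of connectivity predicates of the FIVE points
`(x 0, x 1, x 2, x 3, u)`: the row predicates, their conjunctions and their lifts `liftPred (x i₀) u`.  A certificate for `K ≥ 0` (facecert / ttrl engines)
is an identity between polynomials in the 52 CELL probabilities of the five-point partition lattice.  This file writes every such predicate probability
as a cell sum of the tree's `PatternCells` (nh-dp-blobmono: `Cell v m`, patterns `m < 1024`, `Cons5`, `measureReal_eq_sum_cells`):
* `mrel m : Fin 5 → Fin 5 → Bool` — the connectivity matrix of pattern `m` (`pairNo i j` = the `PatternCells` pair number); inside `Cell v m` the matrix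
  `(i,j) ↦ decide (ω ∈ openConn (v i) (v j))` IS `mrel m` (`connMatrix_eq_mrel`), so for every pattern predicate `Φ` (gen 8's `pev Φ v`):
  **`mem_pev_iff_of_mem_cell`**: `ω ∈ Cell v m → (ω ∈ pev Φ v ↔ Φ (mrel m))`, and
  **`real_pev_eq_sum_cells`**: `μ.real (pev Φ v) = Σ_{m < 1024, Cons5 m ∧ Φ (mrel m)} μ.real (Cell v m)` for every finite measure `μ`;
* `andPat`, `liftPat t u` — conjunction and the lift along the pair `(v t, v u)` at the level of pattern predicates: `pev (andPat Φ Ψ) v = pev Φ v ∩ pev Ψ v`,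
  `connEvent (liftPred (v t) (v u) ·) = pev (liftPat t u Φ) v` (`pev_liftPat`);
* `ext4 Φ` — a four-terminal predicate read on the first four of five points: `pev (ext4 Φ) (Fin.snoc x u) = pev Φ x` (`pev_ext4_snoc`), and the lift along
  `(x i₀, u)` becomes `liftPat (Fin.castSucc i₀) (Fin.last 4)` (`liftPred_ext4_snoc`).
So each term of `key μ⁰ μ¹ (pev Φ₁ x) (pev Φ₂ x) (pev Φ₃ x)` at the pair `(x i₀, u)` is `μ⁰.real (pev Ψ (Fin.snoc x u))` for an explicit five-point predicate `Ψ`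
(**`key_pev_snoc`**), hence an explicit cell sum; the index sets `{m | Cons5 m ∧ Ψ (mrel m)}` are decidable and agree with prim-bnk-1's table
`results/gen9/KEY-TARGETS-52cell.json` (pairs `(0,1),(0,2),(0,3),(0,4),(1,2),(1,3),(1,4),(2,3),(2,4),(3,4)`, bit set = connected).
-/

noncomputable section

namespace Summit.CriticalPhenomena.PercolationContinuityZ3.Theorems

namespace TerminalEdgeInduction

open MeasureTheory Literature.Probability.Percolation Literature.Probability.LatticeModels
open EdgeInduction CovTransferCert E3GroupSepCert PatternCells
open scoped Classical BigOperators

variable {n k : ℕ}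

/-! ### The connectivity matrix of a pattern -/

/-- Pair number of two distinct points among five (`PatternCells` numbering; the diagonal value is irrelevant). [folklore] -/
def pairNo : Fin 5 → Fin 5 → ℕ :=
  fun i j => ![![0, 0, 1, 2, 3], ![0, 0, 4, 5, 6], ![1, 4, 0, 7, 8], ![2, 5, 7, 0, 9], ![3, 6, 8, 9, 0]] i j

/-- The pair number is symmetric. [folklore] -/
theorem pairNo_comm : ∀ i j : Fin 5, pairNo i j = pairNo j i := by decide

/-- Every ordered pair `i < j` is one of the ten numbered pairs. [folklore] -/
theorem exists_pairFin : ∀ i j : Fin 5, i < j → ∃ p : Fin 10, pairFst p = i ∧ pairSnd p = j ∧ p.val = pairNo i j := by decide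

/-- The connectivity matrix of pattern `m`: reflexive, and off the diagonal the bit of the pair. [this work] -/
def mrel (m : ℕ) : Fin 5 → Fin 5 → Bool :=
  fun i j => if i = j then true else Nat.testBit m (pairNo i j)

/-- Inside `Cell v m` two distinct marked points are connected iff the bit of their pair is set. [folklore] -/
theorem reachable_iff_testBit_of_mem_cell (v : Fin 5 → Fin n) {m : ℕ} {ω : BondConfig (Fin n)} (hω : ω ∈ Cell v m)
    {i j : Fin 5} (hij : i ≠ j) : (openGraph ω).Reachable (v i) (v j) ↔ Nat.testBit m (pairNo i j) = true := by
  rcases lt_trichotomy i j with h | h | h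
  · obtain ⟨p, hp1, hp2, hp3⟩ := exists_pairFin i j h
    subst hp1; subst hp2
    rw [← hp3]
    exact hω p
  · exact absurd h hij
  · obtain ⟨p, hp1, hp2, hp3⟩ := exists_pairFin j i h
    subst hp1; subst hp2
    rw [pairNo_comm, ← hp3]
    exact ⟨fun hr => (hω p).1 hr.symm, fun hb => ((hω p).2 hb).symm⟩

/-- **Inside `Cell v m` the connectivity matrix of the five marked points is `mrel m`.** [this work] -/
theorem connMatrix_eq_mrel (v : Fin 5 → Fin n) {m : ℕ} {ω : BondConfig (Fin n)} (hω : ω ∈ Cell v m) :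
    (fun i j => decide (ω ∈ openConn (v i) (v j))) = mrel m := by
  funext i j
  by_cases hij : i = j
  · subst hij
    have h : ω ∈ openConn (v i) (v i) := SimpleGraph.Reachable.refl _
    simp only [mrel, if_true, h, decide_true]
  · have h := reachable_iff_testBit_of_mem_cell v hω hij
    simp only [mrel, if_neg hij]
    by_cases hb : Nat.testBit m (pairNo i j) = true
    · rw [hb]
      exact decide_eq_true (h.2 hb)
    · have hnr : ω ∉ openConn (v i) (v j) := fun hr => hb (h.1 hr)
      rw [Bool.not_eq_true] at hb
      rw [hb]
      exact decide_eq_false hnr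

/-- **Membership in a pattern-predicate event is decided by the cell.** [this work] -/
theorem mem_pev_iff_of_mem_cell (Φ : (Fin 5 → Fin 5 → Bool) → Bool) (v : Fin 5 → Fin n) {m : ℕ} {ω : BondConfig (Fin n)}
    (hω : ω ∈ Cell v m) : ω ∈ pev Φ v ↔ Φ (mrel m) = true := by
  rw [mem_pev_iff, connMatrix_eq_mrel v hω]

/-- **Cell expansion of a five-point pattern-predicate event** (every finite measure). [this work] -/
theorem real_pev_eq_sum_cells (μ : Measure (BondConfig (Fin n))) [IsFiniteMeasure μ] (Φ : (Fin 5 → Fin 5 → Bool) → Bool)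
    (v : Fin 5 → Fin n) :
    μ.real (pev Φ v) = ∑ m ∈ (Finset.range 1024).filter (fun m => Cons5 m = true ∧ Φ (mrel m) = true), μ.real (Cell v m) :=
  measureReal_eq_sum_cells μ v (pev Φ v) (fun m => Φ (mrel m)) fun _ _ _ hω => mem_pev_iff_of_mem_cell Φ v hω

/-! ### Conjunction and lift at the level of pattern predicates -/

/-- Conjunction of pattern predicates. [folklore] -/
def andPat (Φ Ψ : (Fin k → Fin k → Bool) → Bool) : (Fin k → Fin k → Bool) → Bool := fun M => Φ M && Ψ M

/-- `pev (andPat Φ Ψ) x = pev Φ x ∩ pev Ψ x`. [folklore] -/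
theorem pev_andPat (Φ Ψ : (Fin k → Fin k → Bool) → Bool) (x : Fin k → Fin n) : pev (andPat Φ Ψ) x = pev Φ x ∩ pev Ψ x := by
  ext ω
  simp only [mem_pev_iff, andPat, Bool.and_eq_true, Set.mem_inter_iff]

/-- The lift of a pattern predicate along the pair of terminals `(t, u)`: `Φ` read on the matrix with `i ~ j` replaced by
`i ~ j ∨ (i ~ t ∧ u ~ j) ∨ (i ~ u ∧ t ~ j)` (the pattern-level form of `liftPred`). [this work] -/
def liftPat (t u : Fin k) (Φ : (Fin k → Fin k → Bool) → Bool) : (Fin k → Fin k → Bool) → Bool :=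
  fun M => Φ (fun i j => M i j || (M i t && M u j) || (M i u && M t j))

/-- `liftPred` as a lambda (for rewriting un-applied occurrences under `connEvent`). [folklore] -/
theorem liftPred_eq (t u : Fin n) (P : CRel n → Bool) :
    liftPred t u P = fun r => P (fun a b => r a b || (r a t && r u b) || (r a u && r t b)) := rfl

/-- **`liftPred` at two marked points is `liftPat`**: `connEvent (liftPred (x t) (x u) (Φ read at x)) = pev (liftPat t u Φ) x`. [this work] -/
theorem pev_liftPat (t u : Fin k) (Φ : (Fin k → Fin k → Bool) → Bool) (x : Fin k → Fin n) :
    connEvent (liftPred (x t) (x u) (fun r => Φ (fun i j => r (x i) (x j)))) = pev (liftPat t u Φ) x := rfl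

/-! ### Four-terminal predicates read on five points -/

/-- A four-terminal pattern predicate read on the first four of five points. [this work] -/
def ext4 (Φ : (Fin 4 → Fin 4 → Bool) → Bool) : (Fin 5 → Fin 5 → Bool) → Bool :=
  fun M => Φ (fun i j => M (Fin.castSucc i) (Fin.castSucc j))

/-- `pev (ext4 Φ) (Fin.snoc x u) = pev Φ x`. [this work] -/
theorem pev_ext4_snoc (Φ : (Fin 4 → Fin 4 → Bool) → Bool) (x : Fin 4 → Fin n) (u : Fin n) :
    pev (ext4 Φ) (Fin.snoc x u) = pev Φ x := by
  ext ω
  simp only [mem_pev_iff, ext4, Fin.snoc_castSucc]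

/-- The lift along `(x i₀, u)` of a four-terminal predicate read at `x` is the five-point lift `liftPat (castSucc i₀) (last 4)` of `ext4 Φ` read at
`Fin.snoc x u`. [this work] -/
theorem liftPred_ext4_snoc (Φ : (Fin 4 → Fin 4 → Bool) → Bool) (x : Fin 4 → Fin n) (u : Fin n) (i₀ : Fin 4) :
    connEvent (liftPred (x i₀) u (fun r => Φ (fun i j => r (x i) (x j)))) =
      pev (liftPat (Fin.castSucc i₀) (Fin.last 4) (ext4 Φ)) (Fin.snoc x u) := by
  rw [← pev_liftPat]
  simp only [ext4, Fin.snoc_castSucc, Fin.snoc_last]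

/-- `pev Φ x` unfolded (for rewriting `connEvent` statements into `pev` form). [folklore] -/
theorem pev_def (Φ : (Fin k → Fin k → Bool) → Bool) (x : Fin k → Fin n) :
    pev Φ x = connEvent (fun r => Φ (fun i j => r (x i) (x j))) := rfl

/-! ### Cross-checks of the cell index sets against prim-bnk-1's table (results/gen9/KEY-TARGETS-52cell.json, row 44 at `a`) -/

set_option maxRecDepth 100000 in
/-- The consistent patterns of `D[ab|cy]` read on five points (`ext4 (sepPat [0,1] [2,3])`): the 16 masks of the table's `events_cells.A`. [this work] -/
theorem cells_ext4_sep01_23 :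
    ((Finset.range 1024).filter fun m => Cons5 m = true ∧ ext4 (sepPat [0, 1] [2, 3]) (mrel m) = true) =
      {0, 1, 8, 64, 73, 128, 129, 136, 192, 201, 256, 257, 512, 513, 896, 897} := by
  decide

set_option maxRecDepth 100000 in
/-- The consistent patterns of the LIFT of `D[ab|cy]` along `(v 0, v 4)` (= `D[abu|cy]`): the 10 masks of the table's `lifted_events_cells.A`. [this work] -/
theorem cells_lift_ext4_sep01_23 :
    ((Finset.range 1024).filter fun m => Cons5 m = true ∧ liftPat 0 4 (ext4 (sepPat [0, 1] [2, 3])) (mrel m) = true) =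
      {0, 1, 8, 64, 73, 128, 129, 136, 192, 201} := by
  decide

/-! ### The KEY form of a four-terminal pattern row at a (terminal, unmarked) pair, as five-point predicate probabilities -/

/-- **KEY of a pattern row under ONE law, five-point form.**  For pattern predicates `Φ₁ Φ₂ Φ₃` read at `x : Fin 4 → Fin n`, an index `i₀` and a vertex `u`,
`key μ⁰ μ¹ (pev Φ₁ x) (pev Φ₂ x) (pev Φ₃ x)` at the pair `e = s(x i₀, u)` (`μ⁰ = μ_{w[e↦0]}`, `μ¹ = μ_{w[e↦1]}`) is the cubic `key_eq` in the `μ⁰`-probabilities of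
the five-point predicates `ext4 Φᵢ`, their conjunctions and their lifts `liftPat (castSucc i₀) (last 4)`, all read at `v = Fin.snoc x u` — each of which is a
52-cell sum by `real_pev_eq_sum_cells`. [this work] -/
theorem key_pev_snoc (w : Sym2 (Fin n) → unitInterval) (x : Fin 4 → Fin n) (u : Fin n) (i₀ : Fin 4) (Φ₁ Φ₂ Φ₃ : (Fin 4 → Fin 4 → Bool) → Bool) :
    key (prodBernoulli (Function.update w s(x i₀, u) 0)) (prodBernoulli (Function.update w s(x i₀, u) 1)) (pev Φ₁ x) (pev Φ₂ x) (pev Φ₃ x) =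
      let μ := prodBernoulli (Function.update w s(x i₀, u) 0)
      let v : Fin 5 → Fin n := Fin.snoc x u
      let L := liftPat (Fin.castSucc i₀) (Fin.last 4)
      let P₁ := ext4 Φ₁
      let P₂ := ext4 Φ₂
      let P₃ := ext4 Φ₃
      2 * μ.real (pev (L (andPat (andPat P₁ P₂) P₃)) v)
      + (μ.real (pev (L P₁) v) * μ.real (pev P₂ v) * μ.real (pev P₃ v)
          + μ.real (pev P₁ v) * μ.real (pev (L P₂) v) * μ.real (pev P₃ v)
          + μ.real (pev P₁ v) * μ.real (pev P₂ v) * μ.real (pev (L P₃) v))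
      - 2 * (μ.real (pev P₁ v) * μ.real (pev P₂ v) * μ.real (pev P₃ v))
      + (μ.real (pev P₁ v) * μ.real (pev (andPat P₂ P₃) v) + μ.real (pev P₂ v) * μ.real (pev (andPat P₁ P₃) v)
          + μ.real (pev P₃ v) * μ.real (pev (andPat P₁ P₂) v))
      - (μ.real (pev (L P₁) v) * μ.real (pev (andPat P₂ P₃) v) + μ.real (pev P₁ v) * μ.real (pev (L (andPat P₂ P₃)) v)
          + μ.real (pev (L P₂) v) * μ.real (pev (andPat P₁ P₃) v) + μ.real (pev P₂ v) * μ.real (pev (L (andPat P₁ P₃)) v)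
          + μ.real (pev (L P₃) v) * μ.real (pev (andPat P₁ P₂) v) + μ.real (pev P₃ v) * μ.real (pev (L (andPat P₁ P₂)) v)) := by
  -- rewrite the three events as five-point events at `Fin.snoc x u`, then every lifted / intersected probability by `real_update_one_connEvent`
  have hx : ∀ i : Fin 4, (Fin.snoc x u : Fin 5 → Fin n) (Fin.castSucc i) = x i := fun i => by rw [Fin.snoc_castSucc]
  have hu : (Fin.snoc x u : Fin 5 → Fin n) (Fin.last 4) = u := by rw [Fin.snoc_last]
  rw [← pev_ext4_snoc Φ₁ x u, ← pev_ext4_snoc Φ₂ x u, ← pev_ext4_snoc Φ₃ x u]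
  simp only [key_eq, ← pev_andPat]
  simp only [pev_def, real_update_one_connEvent, liftPred_eq, liftPat, ext4, andPat, hx, hu]

end TerminalEdgeInduction

end Summit.CriticalPhenomena.PercolationContinuityZ3.Theorems
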